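import Literature.NumberTheory.Rogawski1990.ArchBouazizSplitWallTools             -- ★ (this seat, (JH-B) tools): Fubini at one place, leaf integrability, split-chart reading; brings ★ p851224 ED. 1, ★ (S7a), ★ (S4a), ★ p850992, ★ (T-CONGR)
import Literature.NumberTheory.Automorphic.ArchWallOrthantFunctionalSmooth        -- ★ p851151 (LH3-p01 (g5)): `exists_isCompact_forall_conj_cayleyTorus_mem_imp_mem` (compact conjugating sets in the Cayley frame)
import Mathlib.Analysis.Calculus.BumpFunction.FiniteDimension                     -- `ContDiffBump` on a finite-dimensional space (the cutoff in the matrix slot)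
import HarnessLib

/-!
# THE WALL-SET REPRESENTATION, TWO-CHART EDITION: ONE curried integrand `g` reads the pi-leaf integral of the compact chart `S` near a wall point `p` of the place `w₀ ∉ S`
# AND the pi-leaf integral of the adjacent split chart `insert w₀ S` near the Cayley point `cayPt w₀ p` (stage (JH-B) of `JH-SPEC.v1.md`; Shelstad 1979 §4 Lemma 4.3, Bouaziz 1994 §3.2 (I₃))

Topic `NumberTheory/Rogawski1990`; namespace `Literature.NumberTheory.Rogawski1990`.  THEOREMS ONLY (no `def`, no instance, no axiom, no `sorry`).  Cell `pub/hodgecm-mathlib`,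
crux H413 (`stmt-HodgeConjecture-24833`), line LH3 (closer stub `stub_N9`, DIRECT ROAD), letter L3′ forward half = the jump clause (J) `ArchBzJump jcH (stOrbFamH L νH fH)`, brick (JH-B)
(LH3-plan (g4) deal 2026-09-02T11:48:06Z; binder of record LH3-p01 (g5), rulings (B3)(B4) 11:51:03Z, «=» (R-B) 12:03:07Z, `JH-SPEC.v2.md` §3).  Author LH10-p01 (g5).  Count-neutral.

WHY.  `H_∞ = ∏_w U(Φ₂)_w × U(Φ₁)_w` has NO descent at a semiregular wall point (the centraliser of the wall element at `w₀` is all of `U(Φ₂)_{w₀}`), so the H-side analogue of the G-side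
descent identities (`hdesc₁ ∕ hdesc₂` of ★ `ArchHcJumpTwoChartOrbital`) is the wall-set representation itself, read in BOTH charts adjacent to the wall: the compact chart `S` (`w₀ ∉ S`)
near the wall point `p` (`p_{w₀}0 = p_{w₀}2`), and the split chart `insert w₀ S` near its Cayley point `cayPt w₀ p`.  ★ p851224 ∕ p851323 give the compact reading; this file re-runs
their construction at `P₀ = {w₀}` with a SINGLE matrix slot and adds the split reading of the SAME `g`.

WHAT.  **`exists_wallSet_representation_twoChart`**: for `fH = Θ ∘ ↑↑ι_∞` (`Θ ∈ C^∞`), Haar measures `ν_w`, the leaves `(Λ_w, Z_w)` of the chart `S` (finite on compacta, σ-finite, closed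
carriers, explicit at the compact places, uniformly proper — ★ p850992 ∕ (JH-A) `exists_twoChart_placeLeaves_stOrbFamH_model`), a SECOND family `(Λ'_w, Z'_w)` for the chart `insert w₀ S`
agreeing with the first off `w₀` (at `w₀`: the split leaf, uniformly proper for the chart `insert w₀ S`), a slab shift `m : ℤ` at `w₀` and a compact `C₁` of base points regular at the compact
places `≠ w₀`, there are a compact `𝒮 ⊆ Π_{w ∉ {w₀}}(U(Φ₂)_w × U(Φ₂)_w)`, a compact `K ⊆ M₂(ℂ)`, a jointly `C^∞` `g : V × M₂(ℂ) → (↥𝒮 →ᵇ ℂ)` with `g(c, Y) = 0` off `K`, a continuous linear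
`ℓ : (↥𝒮 →ᵇ ℂ) →L[ℝ] ℂ`, such that
* `g (c + s • nrm w₀, Y) = g (c, Y)` ((JH-C1): the model reads `c` at `w₀` only through the centre and slot `1`);
* (compact chart) for `c ∈ C₁ ∩ InRegS S`: `∫ fH(eA⁻¹(z_{w,1} γ^S_w(c) z_{w,2} z_{w,1}⁻¹)_w, b(c)) d(⊗Λ) = ℓ(∫_{U(Φ₂)_{w₀}} g(c, ↑↑(h · P t_1(ψ(c)) P⁻¹ · h⁻¹)) dν_{w₀}(h))`, `ψ(c) = (c_{w₀}0 − c_{w₀}2)/2 − mπ`;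
* (split chart) for EVERY `c'` whose wall representative `ĉ' := update c' w₀ (c'_{w₀}2, c'_{w₀}1, c'_{w₀}2)` lies in `C₁` (including the real wall `c'_{w₀}0 = 0`):
  `∫ fH(eA⁻¹(z_{w,1} γ^{insert w₀ S}_w(c') z_{w,2} z_{w,1}⁻¹)_w, b(c')) d(⊗Λ') = ℓ(∫_{U(Φ₂)_{w₀} × U(Φ₂)_{w₀}} g(ĉ', u(ĉ')⁻¹ • ↑↑(z₁ γ^{insert w₀ S}_{w₀}(c') z₂ z₁⁻¹)) dΛ'_{w₀}(z))`, `u(ĉ') = e^{i(c'_{w₀}2 + mπ)}`.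
PROOF.  Compact side = ★ ED. 2 verbatim at `P₀ = {w₀}` (Fubini ★ `integral_unfoldIntegrand_eq_integral_integral`, reading ★ `apply_symm_wallSet_conj_eq_ambientModel`, cutoff `1` on the
circle-saturated shadows, restriction to `𝒮` ★ `integral_eq_integral_subtype_of_support`), then the one-point collapse ★ `integral_pi_subtype_eq_single_of_iff`.  Split side: ★
`integrable_unfoldIntegrand` for the chart `insert w₀ S`, Fubini at `w₀` ★ `integral_pi_eq_integral_integral_update`, the reading ★ `apply_symm_update_split_conj_eq_ambientModel` (the
`U(Φ₁)`-part reads slot `1` only, the blocks off `w₀` are those of the chart `S` at `ĉ'`, the centre cancels), the SAME cutoff (`u(ĉ')⁻¹ • Y` stays in the circle-saturated shadow),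
integrability on the split leaf ★ `integrable_of_null_compl_of_forall_not_mem_eq_zero` (properness + carrier; the leaf is not a group), restriction to the SAME `𝒮` (built over `C₁`).
HONEST LABEL: HC_CM is proved only modulo the 7 printed citations (2 remaining: hLiu418 = stmt-HodgeConjecture-24832, h413 = stmt-HodgeConjecture-24833) until rung 0 closes; bookkeeping
for the (J)-H assembly ((JH-desc) ∕ (JH-asm) of `JH-SPEC.v2.md`), pays nothing by itself.

## References
* [Shelstad1979] D. Shelstad, *Characters and inner forms of a quasi-split group over ℝ*, Compositio Math. 39 (1979), §4 Lemma 4.3 p. 25, Prop. 4.5 p. 26.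
* [Bouaziz1994IntegralesOrbitales] A. Bouaziz, *Intégrales orbitales sur les algèbres de Lie réductives*, Invent. Math. 115 (1994), §3.2 (I₃) p. 580; §6.2 p. 591.
* [Varadarajan1989] V. S. Varadarajan, *An Introduction to Harmonic Analysis on Semisimple Lie Groups*, Cambridge Stud. Adv. Math. 16 (1989), §6.4 Lemma 21, Thm 23.
* [Rogawski1990] J. D. Rogawski, *Automorphic Representations of Unitary Groups in Three Variables*, Ann. of Math. Stud. 123 (1990), §4.8 p. 53; §8.2 p. 122.
* [Folland1995] G. B. Folland, *A Course in Abstract Harmonic Analysis* (1995), §2.6 (2.52).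
* [HormanderALPDO1] L. Hörmander, *The Analysis of Linear Partial Differential Operators I* (1990), §1.1 Thms. 1.1.6–1.1.9.
-/

set_option autoImplicit false

noncomputable section

open MeasureTheory Measure Filter Topology Set Function NumberField NumberField.InfinitePlace NumberField.mixedEmbedding Matrix Complex BoundedContinuousFunction
open Literature.NumberTheory.Automorphic Literature.NumberTheory.Automorphic.UnitaryGroup Literature.NumberTheory.Automorphic.ArchCartan
open scoped ContDiff MatrixGroups Matrix Classical ENNReal NNReal
open scoped Matrix.Norms.Operator

namespace Literature.NumberTheory.Rogawski1990

local notation3 "Φ₂[" L "]" => (Matrix.of fun i j : Fin 2 => if i.val + j.val + 1 = 2 then (1 : L) else 0)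
local notation3 "Φ₁[" L "]" => (Matrix.of fun i j : Fin 1 => if i.val + j.val + 1 = 1 then (1 : L) else 0)
local notation3 "𝔸[" L "]" => ↥(arch (↥(maximalRealSubfield L)) L (IsCMField.complexConj L) 2 Φ₂[L])
local notation3 "𝔹[" L "]" => ↥(arch (↥(maximalRealSubfield L)) L (IsCMField.complexConj L) 1 Φ₁[L])

section Representation

variable (L : Type) [Field L] [NumberField L] [IsCMField L] (S : Finset {w : InfinitePlace L // IsComplex w})
  [∀ w : {w : InfinitePlace L // IsComplex w}, MeasurableSpace ↥(archLocal L 2 Φ₂[L] w)]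
  [∀ w : {w : InfinitePlace L // IsComplex w}, BorelSpace ↥(archLocal L 2 Φ₂[L] w)]

set_option maxHeartbeats 1600000 in
/-- **THE WALL-SET REPRESENTATION OF THE PI-LEAF INTEGRAL, TWO-CHART EDITION.**  Let `fH = Θ ∘ ↑↑ι_∞` with `Θ ∈ C^∞(M₃(L ⊗ ℝ))` (★ `ArchSmooth₂.exists_contDiff`), `ν_w` Haar, `(Λ_w, Z_w)` the
leaves of the compact chart `S` (finite on compacta, σ-finite, closed carriers, EXPLICIT at the compact places `Λ_w = (g ↦ (g,1))_* ν_w`, UNIFORMLY PROPER — the clauses of ★ p850992), `w₀ ∉ S`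
a compact place, `(Λ'_w, Z'_w)` the leaves of the split chart `insert w₀ S`, equal to `(Λ_w, Z_w)` off `w₀` and uniformly proper for the chart `insert w₀ S` (so `Λ'_{w₀}` is the SPLIT leaf
— (JH-A)), `m : ℤ` a slab shift at `w₀`, and `C₁` a compact set of coordinates regular at the compact places off `w₀`.  Then there are a compact `𝒮 ⊆ Π_{w ∉ {w₀}}(U(Φ₂)_w × U(Φ₂)_w)`, a compact
`K ⊆ M₂(ℂ)`, a jointly `C^∞` `g : V × M₂(ℂ) → (↥𝒮 →ᵇ ℂ)` with `g(c, Y) = 0` for `Y ∉ K` and every `c`, and a continuous linear `ℓ : (↥𝒮 →ᵇ ℂ) →L[ℝ] ℂ` with: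
(i) `g (c + s • nrm w₀, Y) = g (c, Y)` (constant along the wall normal); (ii) for every `c ∈ C₁ ∩ InRegS S`,
`∫ fH(eA⁻¹(z_{w,1} γ^S_w(c) z_{w,2} z_{w,1}⁻¹)_w, b(c)) d(⊗Λ) = ℓ(∫_{U(Φ₂)_{w₀}} g(c, ↑↑(h · P t_1(ψ(c)) P⁻¹ · h⁻¹)) dν_{w₀}(h))`, `ψ(c) = (c_{w₀}0 − c_{w₀}2)/2 − mπ`; (iii) for every `c'` whose wall
representative `ĉ' = update c' w₀ (c'_{w₀}2, c'_{w₀}1, c'_{w₀}2)` lies in `C₁`,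
`∫ fH(eA⁻¹(z_{w,1} γ^{insert w₀ S}_w(c') z_{w,2} z_{w,1}⁻¹)_w, b(c')) d(⊗Λ') = ℓ(∫ g(ĉ', (e^{i(c'_{w₀}2 + mπ)})⁻¹ • ↑↑(z₁ γ^{insert w₀ S}_{w₀}(c') z₂ z₁⁻¹)) dΛ'_{w₀}(z))`.
[cite: Varadarajan1989, §6.4 Lemma 21, Thm 23] [cite: Shelstad1979, Lemma 4.3 (p. 25); Prop. 4.5 (p. 26)] [cite: Bouaziz1994IntegralesOrbitales, §3.2 (I₃) p. 580]
[cite: Rogawski1990, §4.8 p. 53; §8.2 p. 122] [cite: Folland1995, §2.6 (2.52)] [cite: HormanderALPDO1, §1.1 Thms. 1.1.6–1.1.9] -/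
theorem exists_wallSet_representation_twoChart {fH : 𝔸[L] × 𝔹[L] → ℂ} (hfc : HasCompactSupport fH) {Θ : Matrix (Fin 3) (Fin 3) (mixedSpace L) → ℂ} (hΘ : ContDiff ℝ ∞ Θ)
    (hΘf : ∀ k, fH k = Θ (((endoEmbArch L k).val : GL (Fin 3) (mixedSpace L)) : Matrix (Fin 3) (Fin 3) (mixedSpace L)))
    (νw : ∀ w : {w : InfinitePlace L // IsComplex w}, Measure ↥(archLocal L 2 Φ₂[L] w)) [∀ w, (νw w).IsHaarMeasure]
    -- the leaves of the compact chart `S` (★ p850992 ∕ (JH-A) clauses)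
    (Λw : ∀ w : {w : InfinitePlace L // IsComplex w}, Measure (↥(archLocal L 2 Φ₂[L] w) × ↥(archLocal L 2 Φ₂[L] w))) [∀ w, IsFiniteMeasureOnCompacts (Λw w)]
    [∀ w, SigmaFinite (Λw w)]
    (Zw : ∀ w : {w : InfinitePlace L // IsComplex w}, Set (↥(archLocal L 2 Φ₂[L] w) × ↥(archLocal L 2 Φ₂[L] w))) (hZcl : ∀ w, IsClosed (Zw w)) (hZnull : ∀ w, Λw w (Zw w)ᶜ = 0)
    (hexpl : ∀ w, w ∉ S → Λw w = Measure.map (fun g : ↥(archLocal L 2 Φ₂[L] w) => (g, (1 : ↥(archLocal L 2 Φ₂[L] w)))) (νw w))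
    (hprop : ∀ (w) (U : Set ({w : InfinitePlace L // IsComplex w} → Fin 3 → ℝ)), IsCompact U → (w ∉ S → ∀ c ∈ U, Circle.exp (c w 0) ≠ Circle.exp (c w 2)) →
      ∀ C' : Set ↥(archLocal L 2 Φ₂[L] w), IsCompact C' →
        ∃ 𝒮 : Set (↥(archLocal L 2 Φ₂[L] w) × ↥(archLocal L 2 Φ₂[L] w)), IsCompact 𝒮 ∧
          ∀ z ∈ Zw w, ∀ c ∈ U, z.1 * (endoBlockAt L S w (c w) * z.2) * z.1⁻¹ ∈ C' → z ∈ 𝒮)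
    -- the wall place `w₀ ∉ S` and the leaves of the ADJACENT split chart `insert w₀ S` ((JH-A): a second family agreeing with `Λw`, `Zw` off `w₀`; at `w₀` the SPLIT leaf)
    {w₀ : {w : InfinitePlace L // IsComplex w}} (hw₀ : w₀ ∉ S)
    (Λw' : ∀ w : {w : InfinitePlace L // IsComplex w}, Measure (↥(archLocal L 2 Φ₂[L] w) × ↥(archLocal L 2 Φ₂[L] w))) [∀ w, IsFiniteMeasureOnCompacts (Λw' w)]
    [∀ w, SigmaFinite (Λw' w)]
    (Zw' : ∀ w : {w : InfinitePlace L // IsComplex w}, Set (↥(archLocal L 2 Φ₂[L] w) × ↥(archLocal L 2 Φ₂[L] w))) (hZ'cl : ∀ w, IsClosed (Zw' w)) (hZ'null : ∀ w, Λw' w (Zw' w)ᶜ = 0)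
    (hΛoff : ∀ w, w ≠ w₀ → Λw' w = Λw w) (hZoff : ∀ w, w ≠ w₀ → Zw' w = Zw w)
    (hprop' : ∀ (w) (U : Set ({w : InfinitePlace L // IsComplex w} → Fin 3 → ℝ)), IsCompact U → (w ∉ insert w₀ S → ∀ c ∈ U, Circle.exp (c w 0) ≠ Circle.exp (c w 2)) →
      ∀ C' : Set ↥(archLocal L 2 Φ₂[L] w), IsCompact C' →
        ∃ 𝒮 : Set (↥(archLocal L 2 Φ₂[L] w) × ↥(archLocal L 2 Φ₂[L] w)), IsCompact 𝒮 ∧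
          ∀ z ∈ Zw' w, ∀ c ∈ U, z.1 * (endoBlockAt L (insert w₀ S) w (c w) * z.2) * z.1⁻¹ ∈ C' → z ∈ 𝒮)
    -- the slab shift at `w₀` (LH3-p01: `0`) and the compact set of base points, regular at the compact places off `w₀`
    (m : ℤ) {C₁ : Set ({w : InfinitePlace L // IsComplex w} → Fin 3 → ℝ)} (hC₁ : IsCompact C₁)
    (hC₁reg : ∀ c ∈ C₁, ∀ w, w ∉ S → w ≠ w₀ → Circle.exp (c w 0) ≠ Circle.exp (c w 2)) :
    ∃ (𝒮 : Set (∀ w : {w : {w : InfinitePlace L // IsComplex w} // w ∉ ({w₀} : Finset {w : InfinitePlace L // IsComplex w})},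
        ↥(archLocal L 2 Φ₂[L] w.1) × ↥(archLocal L 2 Φ₂[L] w.1)))
      (K : Set (Matrix (Fin 2) (Fin 2) ℂ))
      (g : ({w : InfinitePlace L // IsComplex w} → Fin 3 → ℝ) × Matrix (Fin 2) (Fin 2) ℂ → (↥𝒮 →ᵇ ℂ)) (ℓ : (↥𝒮 →ᵇ ℂ) →L[ℝ] ℂ),
      IsCompact 𝒮 ∧ IsCompact K ∧ ContDiff ℝ ∞ g ∧ (∀ c Y, Y ∉ K → g (c, Y) = 0) ∧
      -- (JH-C1) `g` is constant along the wall normal at `w₀`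
      (∀ (c : {w : InfinitePlace L // IsComplex w} → Fin 3 → ℝ) (s : ℝ) (Y : Matrix (Fin 2) (Fin 2) ℂ), g (c + s • nrm w₀, Y) = g (c, Y)) ∧
      -- the COMPACT chart `S`: the pi-leaf integral on `C₁ ∩ InRegS S` is `ℓ` of the whole-group orbital integral of `g(c, ·)` at the Cayley torus point `P t_1(ψ(c)) P⁻¹`
      (∀ c ∈ C₁ ∩ InRegS S,
        (∫ z : ∀ w : {w : InfinitePlace L // IsComplex w}, ↥(archLocal L 2 Φ₂[L] w) × ↥(archLocal L 2 Φ₂[L] w),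
          fH ((archPiEquivCM 2 L Φ₂[L]).symm (fun w => (z w).1 * (endoBlockAt L S w (c w) * (z w).2) * (z w).1⁻¹), (endoTorus L S c).2) ∂(Measure.pi Λw)) =
        ℓ (∫ h : ↥(archLocal L 2 Φ₂[L] w₀),
          g (c, (((h * ⟨Matrix.GeneralLinearGroup.mkOfDetNeZero !![(1 : ℂ), 1; 1, -1] det_cayleyTwo_ne_zero *
              circleDiagonal 2 ![1 * Circle.exp ((c w₀ 0 - c w₀ 2) / 2 - m * Real.pi), 1 * Circle.exp (-((c w₀ 0 - c w₀ 2) / 2 - m * Real.pi))] *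
              (Matrix.GeneralLinearGroup.mkOfDetNeZero !![(1 : ℂ), 1; 1, -1] det_cayleyTwo_ne_zero)⁻¹, cayley_conj_circleDiagonal_mem_archLocal L w₀ _⟩ * h⁻¹ :
            ↥(archLocal L 2 Φ₂[L] w₀)) : GL (Fin 2) ℂ) : Matrix (Fin 2) (Fin 2) ℂ)) ∂(νw w₀))) ∧
      -- the SPLIT chart `insert w₀ S`: at every `c'` whose wall representative `ĉ' := update c' w₀ (c'_{w₀}2, c'_{w₀}1, c'_{w₀}2)` lies in `C₁`, the pi-leaf integral against
      -- `⊗ Λw'` is `ℓ` of the split-leaf integral (against `Λw' w₀`) of `g(ĉ', u(ĉ')⁻¹ • ↑↑(z₁ γ'_{w₀}(c') z₂ z₁⁻¹))`, `u(ĉ') = e^{i(c'_{w₀}2 + mπ)}`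
      (∀ c' : {w : InfinitePlace L // IsComplex w} → Fin 3 → ℝ, Function.update c' w₀ ![c' w₀ 2, c' w₀ 1, c' w₀ 2] ∈ C₁ →
        (∫ z : ∀ w : {w : InfinitePlace L // IsComplex w}, ↥(archLocal L 2 Φ₂[L] w) × ↥(archLocal L 2 Φ₂[L] w),
          fH ((archPiEquivCM 2 L Φ₂[L]).symm (fun w => (z w).1 * (endoBlockAt L (insert w₀ S) w (c' w) * (z w).2) * (z w).1⁻¹), (endoTorus L (insert w₀ S) c').2)
            ∂(Measure.pi Λw')) =
        ℓ (∫ z : ↥(archLocal L 2 Φ₂[L] w₀) × ↥(archLocal L 2 Φ₂[L] w₀),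
          g (Function.update c' w₀ ![c' w₀ 2, c' w₀ 1, c' w₀ 2],
            ((Circle.exp (c' w₀ 2 + m * Real.pi) : ℂ))⁻¹ •
              (((z.1 * (endoBlockAt L (insert w₀ S) w₀ (c' w₀) * z.2) * z.1⁻¹ : ↥(archLocal L 2 Φ₂[L] w₀)) : GL (Fin 2) ℂ) : Matrix (Fin 2) (Fin 2) ℂ)) ∂(Λw' w₀))) := by
  haveI : ∀ w : {w : InfinitePlace L // IsComplex w}, LocallyCompactSpace ↥(archLocal L 2 Φ₂[L] w) := fun w => locallyCompactSpace_archLocal_two L w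
  haveI : ∀ w : {w : InfinitePlace L // IsComplex w}, SecondCountableTopology ↥(archLocal L 2 Φ₂[L] w) := fun w => secondCountableTopology_archLocal_two L w
  have hf : Continuous fH := by
    have h : fH = fun k => Θ (((endoEmbArch L k).val : GL (Fin 3) (mixedSpace L)) : Matrix (Fin 3) (Fin 3) (mixedSpace L)) := funext hΘf
    rw [h]
    exact hΘ.continuous.comp (Units.continuous_val.comp (continuous_subtype_val.comp (continuous_endoEmbArch L)))
  -- the wall set is the one place `w₀`
  set P₀ : Finset {w : InfinitePlace L // IsComplex w} := {w₀} with hP₀_def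
  have hmem₀ : w₀ ∈ P₀ := by rw [hP₀_def]; exact Finset.mem_singleton_self w₀
  have hpP : ∀ w, w ∈ P₀ ↔ w = w₀ := fun w => by rw [hP₀_def, Finset.mem_singleton]
  have hP₀ : ∀ w ∈ P₀, w ∉ S := fun w hw => by rw [(hpP w).1 hw]; exact hw₀
  -- abbreviations: the torus curves at the places of `P₀`, the angle `ψ_i(c)`, the centre `u_i(c)`
  set T : ∀ i : ↥P₀, ℝ → ↥(archLocal L 2 Φ₂[L] i.1) := fun i ψ => ⟨Matrix.GeneralLinearGroup.mkOfDetNeZero !![(1 : ℂ), 1; 1, -1] det_cayleyTwo_ne_zero *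
      circleDiagonal 2 ![1 * Circle.exp ψ, 1 * Circle.exp (-ψ)] * (Matrix.GeneralLinearGroup.mkOfDetNeZero !![(1 : ℂ), 1; 1, -1] det_cayleyTwo_ne_zero)⁻¹,
      cayley_conj_circleDiagonal_mem_archLocal L i.1 _⟩ with hT_def
  set ψf : ↥P₀ → ({w : InfinitePlace L // IsComplex w} → Fin 3 → ℝ) → ℝ := fun i c => (c i.1 0 - c i.1 2) / 2 - m * Real.pi with hψf_def
  -- (1) the multi-place update maps `Λ_w`
  obtain ⟨Λ, -, hΛ⟩ := exists_clm_ambient_endoEmbArch_sub_eq_sum L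
  -- (2) the shadows of the support of `fH` at every place, and the compact `𝒮` of relevant outer leaves over `C₁`
  have hCw : ∀ w : {w : InfinitePlace L // IsComplex w}, IsCompact ((fun k : 𝔸[L] × 𝔹[L] => archPiEquivCM 2 L Φ₂[L] k.1 w) '' tsupport fH) :=
    fun w => hfc.image ((continuous_apply w).comp ((archPiEquivCM 2 L Φ₂[L]).continuous.comp continuous_fst))
  have h𝒮w : ∀ j : {w : {w : InfinitePlace L // IsComplex w} // w ∉ P₀}, ∃ 𝒮j : Set (↥(archLocal L 2 Φ₂[L] j.1) × ↥(archLocal L 2 Φ₂[L] j.1)), IsCompact 𝒮j ∧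
      ∀ z ∈ Zw j.1, ∀ c ∈ C₁, z.1 * (endoBlockAt L S j.1 (c j.1) * z.2) * z.1⁻¹ ∈ (fun k : 𝔸[L] × 𝔹[L] => archPiEquivCM 2 L Φ₂[L] k.1 j.1) '' tsupport fH → z ∈ 𝒮j :=
    fun j => hprop j.1 C₁ hC₁ (fun hjS c hc => hC₁reg c hc j.1 hjS (fun h => j.2 ((hpP j.1).2 h))) _ (hCw j.1)
  choose 𝒮w h𝒮wc h𝒮w using h𝒮w
  set 𝒮 : Set (∀ w : {w : {w : InfinitePlace L // IsComplex w} // w ∉ P₀}, ↥(archLocal L 2 Φ₂[L] w.1) × ↥(archLocal L 2 Φ₂[L] w.1)) := Set.pi univ 𝒮w with h𝒮_def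
  have h𝒮c : IsCompact 𝒮 := isCompact_univ_pi h𝒮wc
  haveI : CompactSpace ↥𝒮 := isCompact_iff_compactSpace.1 h𝒮c
  -- (3) the shadows in `M₂(ℂ)`, circle-saturated: the compact `K₀` containing every relevant matrix tuple, and the cutoff
  have hce : ∀ w : {w : InfinitePlace L // IsComplex w}, IsClosedEmbedding (fun y : ↥(archLocal L 2 Φ₂[L] w) => ((y : GL (Fin 2) ℂ) : Matrix (Fin 2) (Fin 2) ℂ)) := fun w =>
    isClosedEmbedding_coe_unitaryGroupOfForm_of_eq_over (by rw [Literature.NumberTheory.Rogawski1990.antidiagOne_map, StdForm.over_antidiagonal_eq])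
  set Kw : ∀ i : ↥P₀, Set (Matrix (Fin 2) (Fin 2) ℂ) := fun i => (fun p : Circle × Matrix (Fin 2) (Fin 2) ℂ => ((p.1 : ℂ) • p.2)) ''
    (univ ×ˢ ((fun y : ↥(archLocal L 2 Φ₂[L] i.1) => ((y : GL (Fin 2) ℂ) : Matrix (Fin 2) (Fin 2) ℂ)) '' ((fun k : 𝔸[L] × 𝔹[L] => archPiEquivCM 2 L Φ₂[L] k.1 i.1) '' tsupport fH))) with hKw_def
  have hKwc : ∀ i, IsCompact (Kw i) := fun i =>
    ((isCompact_univ : IsCompact (univ : Set Circle)).prod ((hCw i.1).image (hce i.1).continuous)).image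
      ((continuous_subtype_val.comp continuous_fst).smul continuous_snd)
  have hK₀c : IsCompact (Set.pi univ Kw) := isCompact_univ_pi hKwc
  haveI : FiniteDimensional ℝ (Matrix (Fin 2) (Fin 2) ℂ) := Module.Finite.matrix
  obtain ⟨R, hR⟩ := hK₀c.isBounded.subset_closedBall (0 : ↥P₀ → Matrix (Fin 2) (Fin 2) ℂ)
  let χ : ContDiffBump (0 : ↥P₀ → Matrix (Fin 2) (Fin 2) ℂ) := ⟨max R 1, max R 1 + 1, lt_max_of_lt_right one_pos, lt_add_one _⟩
  have hχ1 : ∀ Y ∈ Set.pi univ Kw, χ Y = 1 := fun Y hY =>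
    χ.one_of_mem_closedBall (Metric.closedBall_subset_closedBall (le_max_left _ _) (hR hY))
  have hχ0 : ∀ Y, Y ∉ Metric.closedBall (0 : ↥P₀ → Matrix (Fin 2) (Fin 2) ℂ) (max R 1 + 1) → χ Y = 0 := fun Y hY =>
    χ.zero_of_le_dist (by rw [Metric.mem_closedBall] at hY; exact le_of_lt (not_le.1 hY))
  -- (4) the jointly smooth ambient model times the cutoff, and its reading map on `𝒮`
  set Φm : ({w : InfinitePlace L // IsComplex w} → Matrix (Fin 2) (Fin 2) ℂ × Matrix (Fin 2) (Fin 2) ℂ) ×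
      (({w : InfinitePlace L // IsComplex w} → Fin 3 → ℝ) × (↥P₀ → Matrix (Fin 2) (Fin 2) ℂ)) → ℂ := fun q =>
    ((χ q.2.2 : ℝ) : ℂ) *
      Θ ((((endoEmbArch L (endoTorus L S q.2.1)).val : GL (Fin 3) (mixedSpace L)) : Matrix (Fin 3) (Fin 3) (mixedSpace L)) +
        ∑ i : ↥P₀, Λ i.1 ((((Circle.exp ((q.2.1 i.1 0 + q.2.1 i.1 2) / 2 + m * Real.pi) : Circle) : ℂ) • q.2.2 i : Matrix (Fin 2) (Fin 2) ℂ) -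
          ((endoBlock L S q.2.1 i.1 : GL (Fin 2) ℂ) : Matrix (Fin 2) (Fin 2) ℂ)) +
        ∑ w ∈ Finset.univ.filter (fun w => w ∉ P₀), Λ w ((q.1 w).1 * ((endoBlock L S q.2.1 w : GL (Fin 2) ℂ) : Matrix (Fin 2) (Fin 2) ℂ) * (q.1 w).2 -
          ((endoBlock L S q.2.1 w : GL (Fin 2) ℂ) : Matrix (Fin 2) (Fin 2) ℂ))) with hΦm_def
  have hΦm : ContDiff ℝ ∞ Φm := by
    refine ContDiff.mul ?_ (contDiff_wallSetAmbientModel L S P₀ (fun _ => m) hΘ Λ)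
    exact ofRealCLM.contDiff.comp (χ.contDiff.comp (contDiff_snd.comp contDiff_snd))
  set ιm : ↥𝒮 → ({w : InfinitePlace L // IsComplex w} → Matrix (Fin 2) (Fin 2) ℂ × Matrix (Fin 2) (Fin 2) ℂ) := fun s w =>
    if hw : w ∈ P₀ then ((1 : Matrix (Fin 2) (Fin 2) ℂ), (1 : Matrix (Fin 2) (Fin 2) ℂ))
    else (((((s.1 ⟨w, hw⟩).1 : ↥(archLocal L 2 Φ₂[L] w)) : GL (Fin 2) ℂ) : Matrix (Fin 2) (Fin 2) ℂ),
      ((((s.1 ⟨w, hw⟩).2 * ((s.1 ⟨w, hw⟩).1)⁻¹ : ↥(archLocal L 2 Φ₂[L] w)) : GL (Fin 2) ℂ) : Matrix (Fin 2) (Fin 2) ℂ)) with hιm_def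
  have hιm : Continuous ιm := by
    refine continuous_pi fun w => ?_
    by_cases hw : w ∈ P₀
    · simp only [hιm_def, dif_pos hw]; exact continuous_const
    · simp only [hιm_def, dif_neg hw]
      have hj : Continuous fun s : ↥𝒮 => s.1 ⟨w, hw⟩ := (continuous_apply _).comp continuous_subtype_val
      exact ((hce w).continuous.comp (continuous_fst.comp hj)).prodMk ((hce w).continuous.comp ((continuous_snd.comp hj).mul (continuous_fst.comp hj).inv))
  -- the curried family `g`
  have hgc : ∀ x : ({w : InfinitePlace L // IsComplex w} → Fin 3 → ℝ) × (↥P₀ → Matrix (Fin 2) (Fin 2) ℂ), Continuous fun s : ↥𝒮 => Φm (ιm s, x) := fun x =>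
    hΦm.continuous.comp (hιm.prodMk continuous_const)
  set gm : ({w : InfinitePlace L // IsComplex w} → Fin 3 → ℝ) × (↥P₀ → Matrix (Fin 2) (Fin 2) ℂ) → (↥𝒮 →ᵇ ℂ) := fun x =>
    BoundedContinuousFunction.mkOfCompact ⟨fun s => Φm (ιm s, x), hgc x⟩ with hgm_def
  have hgm_apply : ∀ x s, gm x s = Φm (ιm s, x) := fun _ _ => rfl
  have hgm : ContDiff ℝ ∞ gm := Literature.Analysis.Calculus.contDiff_curry_of_contDiff hΦm hιm hgm_apply
  have hgm0 : ∀ c Y, Y ∉ Metric.closedBall (0 : ↥P₀ → Matrix (Fin 2) (Fin 2) ℂ) (max R 1 + 1) → gm (c, Y) = 0 := by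
    intro c Y hY
    ext s
    rw [hgm_apply, BoundedContinuousFunction.coe_zero, Pi.zero_apply, hΦm_def]
    simp only
    rw [hχ0 Y hY, Complex.ofReal_zero, zero_mul]
  -- (5) the averaging functional on the compact `𝒮`
  have h𝒮meas : MeasurableSet 𝒮 := h𝒮c.isClosed.measurableSet
  set ρ : Measure ↥𝒮 := Measure.comap Subtype.val (Measure.pi fun w : {w : {w : InfinitePlace L // IsComplex w} // w ∉ P₀} => Λw w.1) with hρ_def
  haveI : IsFiniteMeasure ρ := ⟨by rw [hρ_def, comap_subtype_apply_univ _ h𝒮meas]; exact h𝒮c.measure_lt_top⟩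
  obtain ⟨ℓ, hℓ, -⟩ := exists_integral_clm_boundedContinuousFunction (E := ℂ) ρ
  -- (5b) `g` is constant along the wall normals: the model reads `c` at `i₀ ∈ P₀` only through the centre and slot `1`
  have hgminv : ∀ (c : {w : InfinitePlace L // IsComplex w} → Fin 3 → ℝ) (i₀ : ↥P₀) (s : ℝ) (Y : ↥P₀ → Matrix (Fin 2) (Fin 2) ℂ),
      gm (c + s • nrm i₀.1, Y) = gm (c, Y) := by
    intro c i₀ s Y
    have hne : ∀ w, w ≠ i₀.1 → (c + s • nrm i₀.1) w = c w := fun w hw => by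
      funext j; simp [nrm, Pi.single_eq_of_ne hw]
    have h1 : ∀ w, (c + s • nrm i₀.1) w 1 = c w 1 := fun w => by
      by_cases hw : w = i₀.1
      · rw [hw]; simp [nrm]
      · rw [hne w hw]
    have hcen : ∀ i : ↥P₀, ((c + s • nrm i₀.1) i.1 0 + (c + s • nrm i₀.1) i.1 2) / 2 + m * Real.pi = (c i.1 0 + c i.1 2) / 2 + m * Real.pi := by
      intro i
      by_cases hi : i.1 = i₀.1
      · rw [hi]; simp [nrm]; ring
      · rw [hne i.1 hi]
    have hblk : ∀ w, w ≠ i₀.1 → endoBlock L S (c + s • nrm i₀.1) w = endoBlock L S c w := fun w hw => by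
      rw [endoBlock_eq_endoBlockAt, endoBlock_eq_endoBlockAt, hne w hw]
    -- the ambient torus point moves by `Λ_{i₀}(Δγ_{i₀})`
    have hγ' : ∀ c' : {w : InfinitePlace L // IsComplex w} → Fin 3 → ℝ, (archPiEquivCM 2 L Φ₂[L]).symm (fun w => endoBlock L S c' w) = (endoTorus L S c').1 := fun c' => by
      rw [ContinuousMulEquiv.symm_apply_eq]
      funext w
      exact (archPiEquivCM_endoTorus_fst L S c' w).symm
    have hamb : (((endoEmbArch L (endoTorus L S (c + s • nrm i₀.1))).val : GL (Fin 3) (mixedSpace L)) : Matrix (Fin 3) (Fin 3) (mixedSpace L)) =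
        (((endoEmbArch L (endoTorus L S c)).val : GL (Fin 3) (mixedSpace L)) : Matrix (Fin 3) (Fin 3) (mixedSpace L)) +
          Λ i₀.1 (((endoBlock L S (c + s • nrm i₀.1) i₀.1 : GL (Fin 2) ℂ) : Matrix (Fin 2) (Fin 2) ℂ) - ((endoBlock L S c i₀.1 : GL (Fin 2) ℂ) : Matrix (Fin 2) (Fin 2) ℂ)) := by
      have hb : (endoTorus L S (c + s • nrm i₀.1)).2 = (endoTorus L S c).2 := endoTorus_snd_eq_of_forall_apply_one L S S h1
      have h := hΛ (fun w => endoBlock L S c w) (fun w => endoBlock L S (c + s • nrm i₀.1) w) (endoTorus L S c).2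
      rw [hγ', hγ', ← hb, Prod.mk.eta, hb, Prod.mk.eta] at h
      rw [h, Finset.sum_eq_single i₀.1 (fun w _ hw => by rw [hblk w hw, sub_self, map_zero]) (fun h' => absurd (Finset.mem_univ _) h')]
    ext x
    rw [hgm_apply, hgm_apply, hΦm_def]
    simp only
    congr 2
    rw [hamb, Finset.sum_congr rfl fun i _ => by rw [hcen i],
      Finset.sum_congr rfl fun w (hw : w ∈ Finset.univ.filter fun w => w ∉ P₀) => by
        rw [hblk w (fun h => (Finset.mem_filter.1 hw).2 (h ▸ i₀.2))]]
    -- the `i₀`-term absorbs the shift of the ambient point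
    have hsplit : ∀ c' : {w : InfinitePlace L // IsComplex w} → Fin 3 → ℝ,
        ∑ i : ↥P₀, Λ i.1 ((((Circle.exp ((c i.1 0 + c i.1 2) / 2 + m * Real.pi) : Circle) : ℂ) • Y i : Matrix (Fin 2) (Fin 2) ℂ) -
          ((endoBlock L S c' i.1 : GL (Fin 2) ℂ) : Matrix (Fin 2) (Fin 2) ℂ)) =
        ∑ i : ↥P₀, Λ i.1 ((((Circle.exp ((c i.1 0 + c i.1 2) / 2 + m * Real.pi) : Circle) : ℂ) • Y i : Matrix (Fin 2) (Fin 2) ℂ)) -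
          ∑ i : ↥P₀, Λ i.1 (((endoBlock L S c' i.1 : GL (Fin 2) ℂ) : Matrix (Fin 2) (Fin 2) ℂ)) := fun c' => by
      rw [← Finset.sum_sub_distrib]
      exact Finset.sum_congr rfl fun i _ => by rw [map_sub]
    have hγsum : ∑ i : ↥P₀, Λ i.1 (((endoBlock L S (c + s • nrm i₀.1) i.1 : GL (Fin 2) ℂ) : Matrix (Fin 2) (Fin 2) ℂ)) =
        ∑ i : ↥P₀, Λ i.1 (((endoBlock L S c i.1 : GL (Fin 2) ℂ) : Matrix (Fin 2) (Fin 2) ℂ)) +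
          Λ i₀.1 (((endoBlock L S (c + s • nrm i₀.1) i₀.1 : GL (Fin 2) ℂ) : Matrix (Fin 2) (Fin 2) ℂ) - ((endoBlock L S c i₀.1 : GL (Fin 2) ℂ) : Matrix (Fin 2) (Fin 2) ℂ)) := by
      rw [map_sub, ← Finset.sum_erase_add _ _ (Finset.mem_univ i₀), ← Finset.sum_erase_add _ _ (Finset.mem_univ i₀)]
      rw [Finset.sum_congr rfl fun i (hi : i ∈ Finset.univ.erase i₀) => by
        rw [hblk i.1 (fun h => (Finset.mem_erase.1 hi).1 (Subtype.ext h))]]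
      abel
    rw [hsplit, hsplit, hγsum]
    abel
  -- (5c) the SINGLE-SLOT family `g(c, Y) := gm(c, fun _ => Y)` (`P₀ = {w₀}` has one point)
  haveI hP₀ne : Nonempty ↥P₀ := ⟨⟨w₀, hmem₀⟩⟩
  set g : ({w : InfinitePlace L // IsComplex w} → Fin 3 → ℝ) × Matrix (Fin 2) (Fin 2) ℂ → (↥𝒮 →ᵇ ℂ) := fun x => gm (x.1, fun _ => x.2) with hg_def
  have hg_apply : ∀ c Y, g (c, Y) = gm (c, fun _ => Y) := fun _ _ => rfl
  have hg : ContDiff ℝ ∞ g := hgm.comp (contDiff_fst.prodMk (contDiff_pi.2 fun _ => contDiff_snd))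
  have hg0 : ∀ c Y, Y ∉ Metric.closedBall (0 : Matrix (Fin 2) (Fin 2) ℂ) (max R 1 + 1) → g (c, Y) = 0 := by
    intro c Y hY
    rw [hg_apply]
    apply hgm0
    intro hK
    apply hY
    rw [Metric.mem_closedBall, dist_zero_right] at hK ⊢
    rwa [pi_norm_const] at hK
  have hginv : ∀ (c : {w : InfinitePlace L // IsComplex w} → Fin 3 → ℝ) (s : ℝ) (Y : Matrix (Fin 2) (Fin 2) ℂ), g (c + s • nrm w₀, Y) = g (c, Y) :=
    fun c s Y => by rw [hg_apply, hg_apply]; exact hgminv c ⟨w₀, hmem₀⟩ s (fun _ => Y)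
  -- the vector of `P₀`-entries of a single matrix read at `⟨w₀, _⟩` (the dependent conjugates at `i : ↥P₀` as a function of the `w₀`-entry)
  have hvec : ∀ (h : ∀ i : ↥P₀, ↥(archLocal L 2 Φ₂[L] i.1)) (c : {w : InfinitePlace L // IsComplex w} → Fin 3 → ℝ),
      (fun i : ↥P₀ => (((h i * T i (ψf i c) * (h i)⁻¹ : ↥(archLocal L 2 Φ₂[L] i.1)) : GL (Fin 2) ℂ) : Matrix (Fin 2) (Fin 2) ℂ)) =
        fun _ => (((h ⟨w₀, hmem₀⟩ * T ⟨w₀, hmem₀⟩ (ψf ⟨w₀, hmem₀⟩ c) * (h ⟨w₀, hmem₀⟩)⁻¹ : ↥(archLocal L 2 Φ₂[L] w₀)) : GL (Fin 2) ℂ) : Matrix (Fin 2) (Fin 2) ℂ) := by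
    intro h c
    funext i
    obtain ⟨i, hi⟩ := i
    have hi' : i = w₀ := by rw [hP₀_def] at hi; exact Finset.mem_singleton.1 hi
    subst hi'
    rfl
  refine ⟨𝒮, Metric.closedBall 0 (max R 1 + 1), g, ℓ, h𝒮c, isCompact_closedBall _ _, hg, hg0, hginv, fun c hc => ?_, fun c' hĉ => ?_⟩
  -- (6) THE COMPACT CHART `S`: the identity at `c ∈ C₁ ∩ InRegS S` (★ ED. 1 ∕ ED. 2 verbatim at `P₀ = {w₀}`, then the one-point collapse)
  obtain ⟨hcC, hcI⟩ := hc
  have hreg : ∀ w, w ∉ S → Circle.exp (c w 0) ≠ Circle.exp (c w 2) := (mem_inRegS_iff S c).1 hcI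
  -- (6a) Fubini: the places of `P₀` integrated out first
  have hfub := integral_unfoldIntegrand_eq_integral_integral L S fH hf hfc Λw Zw hZcl hZnull νw (fun w => w ∈ P₀) (fun w hw => hexpl w (hP₀ w hw)) c
    (fun w C' hC' => by
      obtain ⟨𝒮', h𝒮', h⟩ := hprop w {c} isCompact_singleton (fun hw c' hc' => by rw [Set.mem_singleton_iff.1 hc']; exact hreg w hw) C' hC'
      exact ⟨𝒮', h𝒮', fun z hz hzC => h z hz c (Set.mem_singleton c) hzC⟩) (endoTorus L S c).2
  rw [hfub]
  -- (6b) the reading of the inner integrand through `g`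
  have hY : ∀ (h : ∀ i : ↥P₀, ↥(archLocal L 2 Φ₂[L] i.1)) (i : ↥P₀),
      (((h i * endoBlockAt L S i.1 (c i.1) * (h i)⁻¹ : ↥(archLocal L 2 Φ₂[L] i.1)) : GL (Fin 2) ℂ) : Matrix (Fin 2) (Fin 2) ℂ) =
        ((Circle.exp ((c i.1 0 + c i.1 2) / 2 + m * Real.pi) : Circle) : ℂ) •
          (((h i * T i (ψf i c) * (h i)⁻¹ : ↥(archLocal L 2 Φ₂[L] i.1)) : GL (Fin 2) ℂ) : Matrix (Fin 2) (Fin 2) ℂ) :=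
    fun h i => coe_conj_endoBlockAt_eq_smul L S i.1 (hP₀ i.1 i.2) c m (h i)
  have hread : ∀ (s : ↥𝒮) (h : ∀ i : ↥P₀, ↥(archLocal L 2 Φ₂[L] i.1)),
      fH ((archPiEquivCM 2 L Φ₂[L]).symm (fun w => if hw : w ∈ P₀ then h ⟨w, hw⟩ * endoBlockAt L S w (c w) * (h ⟨w, hw⟩)⁻¹
        else (s.1 ⟨w, hw⟩).1 * (endoBlockAt L S w (c w) * (s.1 ⟨w, hw⟩).2) * (s.1 ⟨w, hw⟩).1⁻¹), (endoTorus L S c).2) =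
      gm (c, fun i => (((h i * T i (ψf i c) * (h i)⁻¹ : ↥(archLocal L 2 Φ₂[L] i.1)) : GL (Fin 2) ℂ) : Matrix (Fin 2) (Fin 2) ℂ)) s := by
    intro s h
    have hmodel := apply_symm_wallSet_conj_eq_ambientModel L S P₀ (fun _ => m) hP₀ hΘf Λ hΛ s.1 (ιm s) (fun w hw => by simp only [hιm_def, dif_neg hw]) h c
    simp only [] at hmodel
    rw [hgm_apply, hΦm_def]
    simp only
    rw [← hmodel]
    -- the cutoff is `1` where `fH ≠ 0`
    by_cases hzero : fH ((archPiEquivCM 2 L Φ₂[L]).symm (fun w => if hw : w ∈ P₀ then h ⟨w, hw⟩ * endoBlockAt L S w (c w) * (h ⟨w, hw⟩)⁻¹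
        else (s.1 ⟨w, hw⟩).1 * (endoBlockAt L S w (c w) * (s.1 ⟨w, hw⟩).2) * (s.1 ⟨w, hw⟩).1⁻¹), (endoTorus L S c).2) = 0
    · rw [hzero, mul_zero]
    · have hmem : (fun i => (((h i * T i (ψf i c) * (h i)⁻¹ : ↥(archLocal L 2 Φ₂[L] i.1)) : GL (Fin 2) ℂ) : Matrix (Fin 2) (Fin 2) ℂ)) ∈ Set.pi univ Kw := by
        refine Set.mem_univ_pi.2 fun i => ?_
        have hsupp := subset_tsupport fH (Function.mem_support.2 hzero)
        refine ⟨((Circle.exp ((c i.1 0 + c i.1 2) / 2 + m * Real.pi))⁻¹, _), ⟨mem_univ _, ⟨h i * endoBlockAt L S i.1 (c i.1) * (h i)⁻¹, ⟨_, hsupp, ?_⟩, rfl⟩⟩, ?_⟩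
        · show archPiEquivCM 2 L Φ₂[L] ((archPiEquivCM 2 L Φ₂[L]).symm _) i.1 = _
          rw [ContinuousMulEquiv.apply_symm_apply, dif_pos i.2]
        · show (((Circle.exp ((c i.1 0 + c i.1 2) / 2 + m * Real.pi))⁻¹ : Circle) : ℂ) •
              (((h i * endoBlockAt L S i.1 (c i.1) * (h i)⁻¹ : ↥(archLocal L 2 Φ₂[L] i.1)) : GL (Fin 2) ℂ) : Matrix (Fin 2) (Fin 2) ℂ) = _
          rw [hY h i, smul_smul, Circle.coe_inv, inv_mul_cancel₀ (Circle.coe_ne_zero _), one_smul]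
      rw [hχ1 _ hmem, Complex.ofReal_one, one_mul]
  -- (6c) the inner integral at a leaf `s ∈ 𝒮` is the value at `s` of the `E`-valued integral
  have hregP : ∀ i : ↥P₀, Real.sin (ψf i c) ≠ 0 := fun i => sin_wallAngle_ne_zero_of_circleExp_ne (hreg i.1 (hP₀ i.1 i.2)) m
  have hint : Integrable (fun h : ∀ i : ↥P₀, ↥(archLocal L 2 Φ₂[L] i.1) =>
      gm (c, fun i => (((h i * T i (ψf i c) * (h i)⁻¹ : ↥(archLocal L 2 Φ₂[L] i.1)) : GL (Fin 2) ℂ) : Matrix (Fin 2) (Fin 2) ℂ))) (Measure.pi fun i : ↥P₀ => νw i.1) := by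
    -- continuous with compact support (compact conjugating sets at the regular angles `ψ_i(c)`)
    have hcont : Continuous fun h : ∀ i : ↥P₀, ↥(archLocal L 2 Φ₂[L] i.1) =>
        gm (c, fun i => (((h i * T i (ψf i c) * (h i)⁻¹ : ↥(archLocal L 2 Φ₂[L] i.1)) : GL (Fin 2) ℂ) : Matrix (Fin 2) (Fin 2) ℂ)) :=
      hgm.continuous.comp (continuous_const.prodMk (continuous_pi fun i =>
        (hce i.1).continuous.comp (((continuous_apply i).mul continuous_const).mul (continuous_apply i).inv)))
    have h𝒞 : ∀ i : ↥P₀, ∃ 𝒞 : Set ↥(archLocal L 2 Φ₂[L] i.1), IsCompact 𝒞 ∧ ∀ y, ∀ ψ ∈ ({ψf i c} : Set ℝ),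
        y * T i ψ * y⁻¹ ∈ (fun y : ↥(archLocal L 2 Φ₂[L] i.1) => ((y : GL (Fin 2) ℂ) : Matrix (Fin 2) (Fin 2) ℂ)) ⁻¹'
          ((fun Y : ↥P₀ → Matrix (Fin 2) (Fin 2) ℂ => Y i) '' Metric.closedBall (0 : ↥P₀ → Matrix (Fin 2) (Fin 2) ℂ) (max R 1 + 1)) → y ∈ 𝒞 := fun i => by
      have h := exists_isCompact_forall_conj_cayleyTorus_mem_imp_mem L i.1 1 isCompact_singleton (fun ψ hψ => by rw [Set.mem_singleton_iff.1 hψ]; exact hregP i)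
        ((hce i.1).isCompact_preimage ((isCompact_closedBall (0 : ↥P₀ → Matrix (Fin 2) (Fin 2) ℂ) (max R 1 + 1)).image (continuous_apply i)))
      simpa only [hT_def] using h
    choose 𝒞 h𝒞c h𝒞 using h𝒞
    refine hcont.integrable_of_hasCompactSupport (HasCompactSupport.intro (isCompact_univ_pi h𝒞c) fun h hh => ?_)
    obtain ⟨i, -, hi⟩ : ∃ i, i ∈ univ ∧ h i ∉ 𝒞 i := by simpa [Set.mem_univ_pi] using hh
    apply hgm0
    intro hK
    exact hi (h𝒞 i (h i) (ψf i c) (Set.mem_singleton _) ⟨_, hK, rfl⟩)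
  have hinner : ∀ s : ↥𝒮, (∫ h : ∀ i : ↥P₀, ↥(archLocal L 2 Φ₂[L] i.1),
      fH ((archPiEquivCM 2 L Φ₂[L]).symm (fun w => if hw : w ∈ P₀ then h ⟨w, hw⟩ * endoBlockAt L S w (c w) * (h ⟨w, hw⟩)⁻¹
        else (s.1 ⟨w, hw⟩).1 * (endoBlockAt L S w (c w) * (s.1 ⟨w, hw⟩).2) * (s.1 ⟨w, hw⟩).1⁻¹), (endoTorus L S c).2) ∂(Measure.pi fun i : ↥P₀ => νw i.1)) =
      (∫ h : ∀ i : ↥P₀, ↥(archLocal L 2 Φ₂[L] i.1),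
        gm (c, fun i => (((h i * T i (ψf i c) * (h i)⁻¹ : ↥(archLocal L 2 Φ₂[L] i.1)) : GL (Fin 2) ℂ) : Matrix (Fin 2) (Fin 2) ℂ)) ∂(Measure.pi fun i : ↥P₀ => νw i.1)) s := by
    intro s
    have hcomm := (BoundedContinuousFunction.evalCLM ℝ s).integral_comp_comm hint
    simp only [BoundedContinuousFunction.evalCLM_apply] at hcomm
    rw [← hcomm]
    exact integral_congr_ae (Eventually.of_forall fun h => hread s h)
  -- (6d) restriction of the outer integral to `𝒮` and the average
  have hvan : ∀ z' ∈ Set.pi univ (fun w : {w : {w : InfinitePlace L // IsComplex w} // w ∉ P₀} => Zw w.1), z' ∉ 𝒮 →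
      (∫ h : ∀ i : ↥P₀, ↥(archLocal L 2 Φ₂[L] i.1),
        fH ((archPiEquivCM 2 L Φ₂[L]).symm (fun w => if hw : w ∈ P₀ then h ⟨w, hw⟩ * endoBlockAt L S w (c w) * (h ⟨w, hw⟩)⁻¹
          else (z' ⟨w, hw⟩).1 * (endoBlockAt L S w (c w) * (z' ⟨w, hw⟩).2) * (z' ⟨w, hw⟩).1⁻¹), (endoTorus L S c).2) ∂(Measure.pi fun i : ↥P₀ => νw i.1)) = 0 := by
    intro z' hz' hz'𝒮
    obtain ⟨j, -, hj⟩ : ∃ j, j ∈ univ ∧ z' j ∉ 𝒮w j := by simpa [h𝒮_def, Set.mem_univ_pi] using hz'𝒮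
    refine integral_eq_zero_of_ae (Eventually.of_forall fun h => ?_)
    refine image_eq_zero_of_notMem_tsupport fun hmem => hj (h𝒮w j (z' j) (Set.mem_univ_pi.1 hz' j) c hcC ⟨_, hmem, ?_⟩)
    show archPiEquivCM 2 L Φ₂[L] ((archPiEquivCM 2 L Φ₂[L]).symm _) j.1 = _
    rw [ContinuousMulEquiv.apply_symm_apply, dif_neg j.2]
  -- the `Fintype` instance on `↥P₀` inside `Measure.pi` carried by ★'s Fubini clause (`Subtype.fintype`) is irrelevant
  -- (6e) the one-point collapse of the inner integral to `G_{w₀}`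
  have hcoll : (∫ h : ∀ i : ↥P₀, ↥(archLocal L 2 Φ₂[L] i.1),
      gm (c, fun i => (((h i * T i (ψf i c) * (h i)⁻¹ : ↥(archLocal L 2 Φ₂[L] i.1)) : GL (Fin 2) ℂ) : Matrix (Fin 2) (Fin 2) ℂ)) ∂(Measure.pi fun i : ↥P₀ => νw i.1)) =
      ∫ h : ↥(archLocal L 2 Φ₂[L] w₀),
        g (c, (((h * ⟨Matrix.GeneralLinearGroup.mkOfDetNeZero !![(1 : ℂ), 1; 1, -1] det_cayleyTwo_ne_zero *
            circleDiagonal 2 ![1 * Circle.exp ((c w₀ 0 - c w₀ 2) / 2 - m * Real.pi), 1 * Circle.exp (-((c w₀ 0 - c w₀ 2) / 2 - m * Real.pi))] *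
            (Matrix.GeneralLinearGroup.mkOfDetNeZero !![(1 : ℂ), 1; 1, -1] det_cayleyTwo_ne_zero)⁻¹, cayley_conj_circleDiagonal_mem_archLocal L w₀ _⟩ * h⁻¹ :
          ↥(archLocal L 2 Φ₂[L] w₀)) : GL (Fin 2) ℂ) : Matrix (Fin 2) (Fin 2) ℂ)) ∂(νw w₀) := by
    rw [← integral_pi_subtype_eq_single_of_iff (fun w => w ∈ P₀) w₀ hpP νw (fun h : ↥(archLocal L 2 Φ₂[L] w₀) =>
      g (c, (((h * ⟨Matrix.GeneralLinearGroup.mkOfDetNeZero !![(1 : ℂ), 1; 1, -1] det_cayleyTwo_ne_zero *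
          circleDiagonal 2 ![1 * Circle.exp ((c w₀ 0 - c w₀ 2) / 2 - m * Real.pi), 1 * Circle.exp (-((c w₀ 0 - c w₀ 2) / 2 - m * Real.pi))] *
          (Matrix.GeneralLinearGroup.mkOfDetNeZero !![(1 : ℂ), 1; 1, -1] det_cayleyTwo_ne_zero)⁻¹, cayley_conj_circleDiagonal_mem_archLocal L w₀ _⟩ * h⁻¹ :
        ↥(archLocal L 2 Φ₂[L] w₀)) : GL (Fin 2) ℂ) : Matrix (Fin 2) (Fin 2) ℂ)))]
    refine integral_congr_ae (Eventually.of_forall fun h => ?_)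
    show gm _ = g _
    rw [hg_apply, hvec h c]
  refine Eq.trans (integral_congr_ae (Eventually.of_forall fun z' => ?_))
    ((integral_eq_integral_subtype_of_support (Measure.pi fun w : {w : {w : InfinitePlace L // IsComplex w} // w ∉ P₀} => Λw w.1) h𝒮meas
      (pi_compl_null_of_forall _ _ fun w => hZnull w.1) hvan).trans ?_)
  · beta_reduce
    congr 1
    congr 1
    exact Subsingleton.elim _ _
  rw [← hcoll, hℓ]
  exact integral_congr_ae (Eventually.of_forall fun s => hinner s)
  -- (7) THE SPLIT CHART `insert w₀ S` at `c'` with wall representative `ĉ' ∈ C₁`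
  set ĉ : {w : InfinitePlace L // IsComplex w} → Fin 3 → ℝ := Function.update c' w₀ ![c' w₀ 2, c' w₀ 1, c' w₀ 2] with hĉ_def
  have hne_of : ∀ w : {w : {w : InfinitePlace L // IsComplex w} // w ∉ P₀}, w.1 ≠ w₀ := fun w h => w.2 ((hpP w.1).2 h)
  have hnot : ∀ w : {w : InfinitePlace L // IsComplex w}, w ∉ ({w₀} : Finset {w : InfinitePlace L // IsComplex w}) → w ∉ P₀ :=
    fun w hw h => hw (Finset.mem_singleton.2 ((hpP w).1 h))
  have hιmAB : ∀ (s : ↥𝒮) (w : {w : InfinitePlace L // IsComplex w}) (hw : w ∉ ({w₀} : Finset {w : InfinitePlace L // IsComplex w})),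
      ιm s w = (((((s.1 ⟨w, hnot w hw⟩).1 : ↥(archLocal L 2 Φ₂[L] w)) : GL (Fin 2) ℂ) : Matrix (Fin 2) (Fin 2) ℂ),
        ((((s.1 ⟨w, hnot w hw⟩).2 * ((s.1 ⟨w, hnot w hw⟩).1)⁻¹ : ↥(archLocal L 2 Φ₂[L] w)) : GL (Fin 2) ℂ) : Matrix (Fin 2) (Fin 2) ℂ)) := fun s w hw => by
    simp only [hιm_def]
    rw [dif_neg (hnot w hw)]
  -- `Function.update` at ∕ off `w₀`, for ANY decidability instance (the tools' Fubini lemma carries the classical one)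
  have hupd₀ : ∀ {inst : DecidableEq {w : InfinitePlace L // IsComplex w}}
      (G : ∀ w : {w : InfinitePlace L // IsComplex w}, ↥(archLocal L 2 Φ₂[L] w) × ↥(archLocal L 2 Φ₂[L] w)) (z : ↥(archLocal L 2 Φ₂[L] w₀) × ↥(archLocal L 2 Φ₂[L] w₀)),
      @Function.update _ _ inst G w₀ z w₀ = z := fun G z => by
    unfold Function.update
    exact dif_pos rfl
  have hupd₁ : ∀ {inst : DecidableEq {w : InfinitePlace L // IsComplex w}}
      (G : ∀ w : {w : InfinitePlace L // IsComplex w}, ↥(archLocal L 2 Φ₂[L] w) × ↥(archLocal L 2 Φ₂[L] w)) (z : ↥(archLocal L 2 Φ₂[L] w₀) × ↥(archLocal L 2 Φ₂[L] w₀))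
      {w : {w : InfinitePlace L // IsComplex w}}, w ≠ w₀ → @Function.update _ _ inst G w₀ z w = G w := fun G z w hw => by
    unfold Function.update
    exact dif_neg hw
  -- (7a) the conjugate reading `M z = u(ĉ')⁻¹ • ↑↑(z₁ γ'_{w₀}(c') z₂ z₁⁻¹)` on the split leaf (`‖M z‖ = ‖↑↑(z₁ γ' z₂ z₁⁻¹)‖`, the centre is unitary)
  set M : ↥(archLocal L 2 Φ₂[L] w₀) × ↥(archLocal L 2 Φ₂[L] w₀) → Matrix (Fin 2) (Fin 2) ℂ := fun z => ((Circle.exp (c' w₀ 2 + m * Real.pi) : ℂ))⁻¹ •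
      (((z.1 * (endoBlockAt L (insert w₀ S) w₀ (c' w₀) * z.2) * z.1⁻¹ : ↥(archLocal L 2 Φ₂[L] w₀)) : GL (Fin 2) ℂ) : Matrix (Fin 2) (Fin 2) ℂ) with hM_def
  have hMc : Continuous M :=
    (((hce w₀).continuous.comp ((continuous_fst.mul (continuous_const.mul continuous_snd)).mul continuous_fst.inv)).const_smul
      (((Circle.exp (c' w₀ 2 + m * Real.pi) : ℂ))⁻¹))
  have hnormM : ∀ z, ‖M z‖ = ‖(((z.1 * (endoBlockAt L (insert w₀ S) w₀ (c' w₀) * z.2) * z.1⁻¹ : ↥(archLocal L 2 Φ₂[L] w₀)) : GL (Fin 2) ℂ) : Matrix (Fin 2) (Fin 2) ℂ)‖ := by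
    intro z
    rw [hM_def]
    simp only
    rw [_root_.norm_smul, norm_inv, Circle.norm_coe, inv_one, one_mul]
  -- (7b) properness of the `insert w₀ S`-leaves at the point `c'` (at a compact place `w ∉ S`, `w ≠ w₀`: `c' w = ĉ' w`, regular since `ĉ' ∈ C₁`)
  have hpropc : ∀ (w) (C' : Set ↥(archLocal L 2 Φ₂[L] w)), IsCompact C' →
      ∃ 𝒮' : Set (↥(archLocal L 2 Φ₂[L] w) × ↥(archLocal L 2 Φ₂[L] w)), IsCompact 𝒮' ∧
        ∀ z ∈ Zw' w, z.1 * (endoBlockAt L (insert w₀ S) w (c' w) * z.2) * z.1⁻¹ ∈ C' → z ∈ 𝒮' := by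
    intro w C' hC'
    obtain ⟨𝒮', h𝒮', h⟩ := hprop' w {c'} isCompact_singleton (fun hw c hc => by
      rw [Set.mem_singleton_iff.1 hc]
      have hwS : w ∉ S := fun h' => hw (Finset.mem_insert_of_mem h')
      have hww : w ≠ w₀ := fun h' => hw (h' ▸ Finset.mem_insert_self w₀ S)
      have hreg := hC₁reg ĉ hĉ w hwS hww
      rwa [hĉ_def, wallRep_apply_of_ne L c' hww] at hreg) C' hC'
    exact ⟨𝒮', h𝒮', fun z hz hmem => h z hz c' (Set.mem_singleton c') hmem⟩
  -- (7c) Fubini at `w₀` (★ tools): the split leaf integrated out first; the outer leaves are those of the chart `S`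
  have hintS : Integrable (fun z : ∀ w : {w : InfinitePlace L // IsComplex w}, ↥(archLocal L 2 Φ₂[L] w) × ↥(archLocal L 2 Φ₂[L] w) =>
      fH ((archPiEquivCM 2 L Φ₂[L]).symm (fun w => (z w).1 * (endoBlockAt L (insert w₀ S) w (c' w) * (z w).2) * (z w).1⁻¹), (endoTorus L (insert w₀ S) c').2))
      (Measure.pi Λw') :=
    integrable_unfoldIntegrand L (insert w₀ S) fH hf hfc Λw' Zw' hZ'cl hZ'null c' hpropc (endoTorus L (insert w₀ S) c').2
  have hout : (Measure.pi fun w : {w : {w : InfinitePlace L // IsComplex w} // w ∉ P₀} => Λw' w.1) =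
      Measure.pi fun w : {w : {w : InfinitePlace L // IsComplex w} // w ∉ P₀} => Λw w.1 :=
    congrArg Measure.pi (funext fun w => hΛoff w.1 (hne_of w))
  rw [integral_pi_eq_integral_integral_update (fun w => w ∈ P₀) w₀ hpP Λw' (fun _ => (1, 1)) hintS, hout]
  -- (7d) the cutoff is `1` where `fH ≠ 0` (generic in the point `k`), and the circle-saturated shadow at `w₀`
  have hcut : ∀ (s : ↥𝒮) (Y : Matrix (Fin 2) (Fin 2) ℂ) (k : 𝔸[L] × 𝔹[L]),
      ((χ (fun _ : ↥P₀ => Y) : ℝ) : ℂ) * fH k = gm (ĉ, fun _ => Y) s → (fH k ≠ 0 → (fun _ : ↥P₀ => Y) ∈ Set.pi univ Kw) → fH k = g (ĉ, Y) s := by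
    intro s Y k h1 h2
    rw [hg_apply, ← h1]
    by_cases hz : fH k = 0
    · rw [hz, mul_zero]
    · rw [hχ1 _ (h2 hz), Complex.ofReal_one, one_mul]
  have hshadow : ∀ (F : ∀ w : {w : InfinitePlace L // IsComplex w}, ↥(archLocal L 2 Φ₂[L] w)) (b : 𝔹[L]) (z : ↥(archLocal L 2 Φ₂[L] w₀) × ↥(archLocal L 2 Φ₂[L] w₀)),
      F w₀ = z.1 * (endoBlockAt L (insert w₀ S) w₀ (c' w₀) * z.2) * z.1⁻¹ → fH ((archPiEquivCM 2 L Φ₂[L]).symm F, b) ≠ 0 → (fun _ : ↥P₀ => M z) ∈ Set.pi univ Kw := by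
    intro F b z hF hne
    have hsupp := subset_tsupport fH (Function.mem_support.2 hne)
    have hMz : M z = (((Circle.exp (c' w₀ 2 + m * Real.pi))⁻¹ : Circle) : ℂ) •
        (((z.1 * (endoBlockAt L (insert w₀ S) w₀ (c' w₀) * z.2) * z.1⁻¹ : ↥(archLocal L 2 Φ₂[L] w₀)) : GL (Fin 2) ℂ) : Matrix (Fin 2) (Fin 2) ℂ) := by
      rw [hM_def, Circle.coe_inv]
    refine Set.mem_univ_pi.2 fun i => ?_
    obtain ⟨i, hi⟩ := i
    have hi' : i = w₀ := (hpP i).1 hi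
    subst hi'
    rw [hMz]
    exact ⟨(_, _), ⟨mem_univ _, ⟨_, ⟨_, hsupp, by
      show archPiEquivCM 2 L Φ₂[L] ((archPiEquivCM 2 L Φ₂[L]).symm F) i = _
      rw [ContinuousMulEquiv.apply_symm_apply, hF]⟩, rfl⟩⟩, rfl⟩
  -- (7e) integrability of `z ↦ g(ĉ', M z)` on the split leaf (★ tools: properness at `w₀` + the carrier `Zw' w₀`; the leaf is not a group)
  have hint' : Integrable (fun z : ↥(archLocal L 2 Φ₂[L] w₀) × ↥(archLocal L 2 Φ₂[L] w₀) => g (ĉ, M z)) (Λw' w₀) := by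
    obtain ⟨𝒮', h𝒮', h𝒮'p⟩ := hpropc w₀ _ ((hce w₀).isCompact_preimage (isCompact_closedBall (0 : Matrix (Fin 2) (Fin 2) ℂ) (max R 1 + 1)))
    refine integrable_of_null_compl_of_forall_not_mem_eq_zero (Λw' w₀) (hZ'cl w₀) (hZ'null w₀) (hg.continuous.comp (continuous_const.prodMk hMc)) h𝒮'
      fun z hz hz𝒮 => ?_
    by_contra hne
    refine hz𝒮 (h𝒮'p z hz ?_)
    show (((z.1 * (endoBlockAt L (insert w₀ S) w₀ (c' w₀) * z.2) * z.1⁻¹ : ↥(archLocal L 2 Φ₂[L] w₀)) : GL (Fin 2) ℂ) : Matrix (Fin 2) (Fin 2) ℂ) ∈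
      Metric.closedBall (0 : Matrix (Fin 2) (Fin 2) ℂ) (max R 1 + 1)
    rw [mem_closedBall_zero_iff, ← hnormM z, ← mem_closedBall_zero_iff]
    by_contra hK
    exact hne (hg0 ĉ (M z) hK)
  -- (7f) restriction of the outer integral to `𝒮` (off `𝒮` the integrand vanishes on the carrier: the blocks off `w₀` are those of the chart `S` at `ĉ' ∈ C₁`) and the average
  rw [hℓ, integral_eq_integral_subtype_of_support (Measure.pi fun w : {w : {w : InfinitePlace L // IsComplex w} // w ∉ P₀} => Λw w.1) h𝒮meas
    (pi_compl_null_of_forall _ _ fun w => hZnull w.1) ?_]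
  · refine integral_congr_ae (Eventually.of_forall fun s => ?_)
    -- (7g) the inner integral at a leaf `s ∈ 𝒮` is the value at `s` of the `E`-valued split-leaf integral of `g(ĉ', M ·)`
    have hcomm := (BoundedContinuousFunction.evalCLM ℝ s).integral_comp_comm hint'
    simp only [BoundedContinuousFunction.evalCLM_apply] at hcomm
    refine Eq.trans ?_ hcomm
    refine integral_congr_ae (Eventually.of_forall fun z => ?_)
    refine hcut s (M z) _ ?_ ?_
    · -- the reading identity of the split chart (★ tools), the leaf point family `U` read off the goal by unification
      rw [hgm_apply, hΦm_def]
      simp only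
      refine (congrArg (fun t : ℂ => ((χ (fun _ : ↥P₀ => M z) : ℝ) : ℂ) * t)
        (apply_symm_update_split_conj_eq_ambientModel L S hw₀ hΘf Λ hΛ m s.1 (ιm s) (hιmAB s) z _ ?_ ?_ c')).trans ?_
      · exact hupd₀ _ z
      · intro w hw
        rw [hupd₁ _ z (fun h => hnot w hw ((hpP w).2 h)), dif_neg (hnot w hw)]
      · rw [hM_def, hĉ_def]
    · intro hne
      exact hshadow _ _ z (by rw [hupd₀ _ z]) hne
  · -- (7f′) vanishing off `𝒮`
    intro z' hz' hz'𝒮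
    obtain ⟨j, -, hj⟩ : ∃ j, j ∈ univ ∧ z' j ∉ 𝒮w j := by simpa [h𝒮_def, Set.mem_univ_pi] using hz'𝒮
    refine integral_eq_zero_of_ae (Eventually.of_forall fun z => ?_)
    refine image_eq_zero_of_notMem_tsupport fun hmem => hj (h𝒮w j (z' j) (Set.mem_univ_pi.1 hz' j) ĉ hĉ ⟨_, hmem, ?_⟩)
    show archPiEquivCM 2 L Φ₂[L] ((archPiEquivCM 2 L Φ₂[L]).symm _) j.1 = _
    rw [ContinuousMulEquiv.apply_symm_apply]
    rw [hupd₁ _ z (hne_of j), dif_neg j.2, endoBlockAt_insert_eq_endoBlockAt_wallRep L S c' (hne_of j), ← hĉ_def]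

end Representation

end Literature.NumberTheory.Rogawski1990

end
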